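import Summits.Ventures.CertifiedManyBodySolver.Transport.ChainWindowSpinRotation
import HarnessLib

/-!
# Ventures/CertifiedManyBodySolver — Transport/ChainWindowSpinRotationRows.lean

Speedrun cell sr-mbsolver / programme hubbard-alg — LIT team (lit-1 gen-13), LEAD ruling r156 (g1) object **LD1′**, part 2/2 of the
window-level transport (part 1 = `Transport/ChainWindowSpinRotation.lean`: the staggered family `v_x`, `V = ⨂_x v_x` as a signed
permutation of configurations, the bond observables of the standard and `jw-srot` forms in the product basis).
HONEST FRAMING: first certified bounds; not a superconductivity verdict; every number certified or labelled float.

WHAT THIS GIVES. §5: every row of the standard `lti(N)` node of the Hubbard chain (`Rows.LTIChainKSDNNode`: PSD, trace, local translation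
invariance, sectors, total density of site `-1`, real, bound) is carried by `ρ ↦ V ρ Vᴴ` to the corresponding row of the `jw-srot` node
once `ρ` is spin-flip invariant — in particular the LTI ROW (`spinRot_ltiRow`: the two partial traces transport `V` to `⨂_x v_{x+1} =
(⨂_x v_x)(⨂_x u)` resp. `⨂_x v_x`, and the common marginal of an `F`-invariant `ρ` is invariant under the small window's spin flip) — and
the `jw-srot` bond objective at `V ρ Vᴴ` equals the standard bond objective at `ρ` (`spinRot_srotObjective`). §6: **`ksdnClaim_of_srotClaim`**
— the `jw-srot` window statement (TOTAL-OCCUPATION sectors, bond `U n_{-1↑}n_{-1↓} − t Σ_σ (c†_{-1σ} c_{0σ̄} + h.c.)`) IMPLIES the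
standard window statement = the `hclaim` of `lti_primal_chainWindow_energyDensity[At]_ge_ksdn` (by name `Rows.LTIChainKSDNNode`):
spin-flip midpoint `ρ₁ = ½(ρ + FρF)` (`ChainWindowMidpoint.lean`, `ChainWindowSpinFlip.lean`), then `ρ₂ = V ρ₁ Vᴴ`.
Nothing is asserted; no definition, no `sorry`, no new axiom, no named fact.
[cite: KullEtAl2024, §II.B eq. (locTIn), §VI.B] [cite: EsslerEtAl2005, §12.3.4 eqs. (12.196)–(12.201)] [cite: NielsenChuang2010, §2.4.3 Box 2.6]
-/

noncomputable section

open Matrix Complex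
open scoped ComplexOrder BigOperators
open Literature.Probability.LatticeModels
open Literature.MathematicalPhysics.QuantumLattice
open Literature.MathematicalPhysics.QuantumLattice.HubbardWave0
open Literature.MathematicalPhysics.QuantumLattice.JordanWigner

namespace Summit.Ventures.CertifiedManyBodySolver.Transport

/-! ### §5 The rows of the window `{-1, …, n+1}` under `V` -/

section Rows

variable (n : ℕ)

/-- `0 = (-1) + 1` in coordinates. [folklore] -/
theorem zero_apply_eq_neg_unitVec_apply_add_one : (0 : Site 1) 0 = (-unitVec 0 : Site 1) 0 + 1 := by
  rw [Pi.neg_apply, chain_unitVec_apply_zero, Pi.zero_apply]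
  norm_num

/-- The site `-1` is odd. [folklore] -/
theorem odd_neg_unitVec_apply : Odd ((-unitVec 0 : Site 1) 0) := by
  rw [Pi.neg_apply, chain_unitVec_apply_zero]
  exact ⟨-1, by norm_num⟩

/-- **THE LTI ROW UNDER `V`.** If `ρ` is locally translation invariant and spin-flip invariant (`F ρ Fᴴ = ρ`) then `V ρ Vᴴ` is
locally translation invariant: on the `(n+2)`-site window the two partial traces carry `V` to `⨂_x v_{x+1} = (⨂_x v_x) · (⨂_x u)`
resp. `⨂_x v_x`, and the common marginal of `ρ` is invariant under the small window's spin flip.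
[cite: KullEtAl2024, §II.B eq. (locTIn)] [cite: NielsenChuang2010, §2.4.3 Box 2.6] -/
theorem spinRot_ltiRow {ρ : Op (PolySite (chainWindow (-1) ((n : ℤ) + 1))) 4}
    (hLTI : spinPartialTrace ((PolySite.affEmb 1 (unitVec 0) (chainWindow (-1) (n : ℤ))).trans
        (PolySite.incl (affShiftSet_chainWindow_subset (-1) (n : ℤ)))) ρ =
      spinPartialTrace (PolySite.incl (chainWindow_mono_right (-1) (by omega : (n : ℤ) ≤ n + 1))) ρ)
    (hinv : productOp (fun _ => uSpinFlip) * ρ * (productOp (fun _ => uSpinFlip))ᴴ = ρ) :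
    spinPartialTrace ((PolySite.affEmb 1 (unitVec 0) (chainWindow (-1) (n : ℤ))).trans
        (PolySite.incl (affShiftSet_chainWindow_subset (-1) (n : ℤ))))
        (productOp oddSiteSpinFlip * ρ * (productOp oddSiteSpinFlip)ᴴ) =
      spinPartialTrace (PolySite.incl (chainWindow_mono_right (-1) (by omega : (n : ℤ) ≤ n + 1)))
        (productOp oddSiteSpinFlip * ρ * (productOp oddSiteSpinFlip)ᴴ) := by
  have hφ₀ := shift_incl (chainWindow_mono_right (-1) (by omega : (n : ℤ) ≤ n + 1))
  have hφ₁ : ∀ y, ofLex (((PolySite.affEmb 1 (unitVec 0) (chainWindow (-1) (n : ℤ))).trans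
      (PolySite.incl (affShiftSet_chainWindow_subset (-1) (n : ℤ)))) y).1 0 = ofLex y.1 0 + 1 := fun y => by
    rw [shift_affEmb_trans_incl, chain_unitVec_apply_zero]
  rw [spinPartialTrace_productOp_conj _ oddSiteSpinFlip_mem_unitaryGroup ρ,
    spinPartialTrace_productOp_conj _ oddSiteSpinFlip_mem_unitaryGroup ρ, hLTI]
  -- the two transported families
  have h0 : (fun x : PolySite (chainWindow (-1) (n : ℤ)) =>
      oddSiteSpinFlip (PolySite.incl (chainWindow_mono_right (-1) (by omega : (n : ℤ) ≤ n + 1)) x)) = oddSiteSpinFlip := by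
    funext x
    rw [oddSiteSpinFlip, oddSiteSpinFlip, hφ₀ x, add_zero]
  have h1 : productOp (fun x : PolySite (chainWindow (-1) (n : ℤ)) =>
      oddSiteSpinFlip (((PolySite.affEmb 1 (unitVec 0) (chainWindow (-1) (n : ℤ))).trans
        (PolySite.incl (affShiftSet_chainWindow_subset (-1) (n : ℤ)))) x)) =
      productOp oddSiteSpinFlip * productOp (fun _ => uSpinFlip) := by
    rw [productOp_mul]
    refine congrArg productOp (funext fun x => ?_)
    rw [oddSiteSpinFlip, oddSiteSpinFlip, hφ₁ x]
    by_cases hx : Odd (ofLex x.1 0)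
    · rw [if_pos hx, if_neg (by rw [Int.not_odd_iff_even]; exact hx.add_one), uSpinFlip_mul_self]
    · rw [if_neg hx, if_pos (by rw [Int.not_odd_iff_even] at hx; exact hx.add_one), Matrix.one_mul]
  -- the common marginal is invariant under the small window's spin flip
  have hM : productOp (fun _ => uSpinFlip) *
      spinPartialTrace (PolySite.incl (chainWindow_mono_right (-1) (by omega : (n : ℤ) ≤ n + 1))) ρ *
        (productOp (fun _ => uSpinFlip))ᴴ =
      spinPartialTrace (PolySite.incl (chainWindow_mono_right (-1) (by omega : (n : ℤ) ≤ n + 1))) ρ := by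
    have key := spinPartialTrace_productOp_conj
      (PolySite.incl (chainWindow_mono_right (-1) (by omega : (n : ℤ) ≤ n + 1)))
      (fun _ : PolySite (chainWindow (-1) ((n : ℤ) + 1)) => uSpinFlip_mem_unitaryGroup) ρ
    rw [hinv] at key
    exact key.symm
  rw [h0, h1, Matrix.conjTranspose_mul]
  calc productOp oddSiteSpinFlip * productOp (fun _ => uSpinFlip) *
        spinPartialTrace (PolySite.incl (chainWindow_mono_right (-1) (by omega : (n : ℤ) ≤ n + 1))) ρ *
        ((productOp fun _ => uSpinFlip)ᴴ * (productOp oddSiteSpinFlip)ᴴ)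
      = productOp oddSiteSpinFlip * (productOp (fun _ => uSpinFlip) *
          spinPartialTrace (PolySite.incl (chainWindow_mono_right (-1) (by omega : (n : ℤ) ≤ n + 1))) ρ *
          (productOp fun _ => uSpinFlip)ᴴ) * (productOp oddSiteSpinFlip)ᴴ := by
        simp only [Matrix.mul_assoc]
    _ = productOp oddSiteSpinFlip *
          spinPartialTrace (PolySite.incl (chainWindow_mono_right (-1) (by omega : (n : ℤ) ≤ n + 1))) ρ *
          (productOp oddSiteSpinFlip)ᴴ := by rw [hM]

/-- **The density row under `V`**: the total density of site `-1` is unchanged. [cite: KullEtAl2024, §II.B] -/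
theorem spinRot_ksdnDensityRow {ρ : Op (PolySite (chainWindow (-1) ((n : ℤ) + 1))) 4} {ν : ℝ}
    (hdens : ((toSpin (nAt (-unitVec 0) (neg_unitVec_mem_chainWindow (by omega : (-1 : ℤ) ≤ n + 1)) 0 +
        nAt (-unitVec 0) (neg_unitVec_mem_chainWindow (by omega : (-1 : ℤ) ≤ n + 1)) 1) * ρ).trace).re = ν) :
    ((toSpin (nAt (-unitVec 0) (neg_unitVec_mem_chainWindow (by omega : (-1 : ℤ) ≤ n + 1)) 0 +
        nAt (-unitVec 0) (neg_unitVec_mem_chainWindow (by omega : (-1 : ℤ) ≤ n + 1)) 1) *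
        (productOp oddSiteSpinFlip * ρ * (productOp oddSiteSpinFlip)ᴴ)).trace).re = ν := by
  rw [trace_mul_conj_of_conj (conjTranspose_conj_eq_of_conj_eq spinRot_conjTranspose_mul_self
    (spinRot_conj_toSpin_siteTotal _ _)), hdens]

/-- **The density row under the spin flip `F`**: the total density of site `-1` is unchanged. [cite: KullEtAl2024, §II.B] -/
theorem spinFlip_ksdnDensityRow {ρ : Op (PolySite (chainWindow (-1) ((n : ℤ) + 1))) 4} {ν : ℝ}
    (hdens : ((toSpin (nAt (-unitVec 0) (neg_unitVec_mem_chainWindow (by omega : (-1 : ℤ) ≤ n + 1)) 0 +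
        nAt (-unitVec 0) (neg_unitVec_mem_chainWindow (by omega : (-1 : ℤ) ≤ n + 1)) 1) * ρ).trace).re = ν) :
    ((toSpin (nAt (-unitVec 0) (neg_unitVec_mem_chainWindow (by omega : (-1 : ℤ) ≤ n + 1)) 0 +
        nAt (-unitVec 0) (neg_unitVec_mem_chainWindow (by omega : (-1 : ℤ) ≤ n + 1)) 1) *
        (productOp (fun _ => uSpinFlip) * ρ * (productOp (fun _ => uSpinFlip))ᴴ)).trace).re = ν := by
  rw [trace_mul_conj_of_conj (conjTranspose_conj_eq_of_conj_eq spinFlip_conjTranspose_mul_self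
    (spinFlip_conj_toSpin_siteTotal _ _)), hdens]

/-- **The standard bond objective is spin-flip invariant** (as an expectation). [cite: KullEtAl2024, §II.B] -/
theorem spinFlip_ksdnObjective (t U : ℝ) (ρ : Op (PolySite (chainWindow (-1) ((n : ℤ) + 1))) 4) :
    ((toSpin ((U : ℂ) • (nAt (-unitVec 0) (neg_unitVec_mem_chainWindow (by omega : (-1 : ℤ) ≤ n + 1)) 0 *
            nAt (-unitVec 0) (neg_unitVec_mem_chainWindow (by omega : (-1 : ℤ) ≤ n + 1)) 1) +
          (-(t : ℂ)) • ∑ σ : Fin 2,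
            ((cAt (-unitVec 0) (neg_unitVec_mem_chainWindow (by omega : (-1 : ℤ) ≤ n + 1)) σ)ᴴ *
                cAt 0 (zero_mem_chainWindow (by omega : (0 : ℤ) ≤ n + 1)) σ +
              (cAt 0 (zero_mem_chainWindow (by omega : (0 : ℤ) ≤ n + 1)) σ)ᴴ *
                cAt (-unitVec 0) (neg_unitVec_mem_chainWindow (by omega : (-1 : ℤ) ≤ n + 1)) σ)) *
        (productOp (fun _ => uSpinFlip) * ρ * (productOp (fun _ => uSpinFlip))ᴴ)).trace).re =
      ((toSpin ((U : ℂ) • (nAt (-unitVec 0) (neg_unitVec_mem_chainWindow (by omega : (-1 : ℤ) ≤ n + 1)) 0 *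
            nAt (-unitVec 0) (neg_unitVec_mem_chainWindow (by omega : (-1 : ℤ) ≤ n + 1)) 1) +
          (-(t : ℂ)) • ∑ σ : Fin 2,
            ((cAt (-unitVec 0) (neg_unitVec_mem_chainWindow (by omega : (-1 : ℤ) ≤ n + 1)) σ)ᴴ *
                cAt 0 (zero_mem_chainWindow (by omega : (0 : ℤ) ≤ n + 1)) σ +
              (cAt 0 (zero_mem_chainWindow (by omega : (0 : ℤ) ≤ n + 1)) σ)ᴴ *
                cAt (-unitVec 0) (neg_unitVec_mem_chainWindow (by omega : (-1 : ℤ) ≤ n + 1)) σ)) * ρ).trace).re := by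
  rw [trace_mul_conj_of_conj (conjTranspose_conj_eq_of_conj_eq spinFlip_conjTranspose_mul_self
    (spinFlip_conj_toSpin_ksdnBond t U _ _ (zero_apply_eq_neg_unitVec_apply_add_one)))]

/-- **The `jw-srot` bond objective at `V ρ Vᴴ` is the standard bond objective at `ρ`.** [cite: KullEtAl2024, §II.B] -/
theorem spinRot_srotObjective (t U : ℝ) (ρ : Op (PolySite (chainWindow (-1) ((n : ℤ) + 1))) 4) :
    ((toSpin ((U : ℂ) • (nAt (-unitVec 0) (neg_unitVec_mem_chainWindow (by omega : (-1 : ℤ) ≤ n + 1)) 0 *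
            nAt (-unitVec 0) (neg_unitVec_mem_chainWindow (by omega : (-1 : ℤ) ≤ n + 1)) 1) +
          (-(t : ℂ)) • ∑ σ : Fin 2,
            ((cAt (-unitVec 0) (neg_unitVec_mem_chainWindow (by omega : (-1 : ℤ) ≤ n + 1)) σ)ᴴ *
                cAt 0 (zero_mem_chainWindow (by omega : (0 : ℤ) ≤ n + 1)) σ.rev +
              (cAt 0 (zero_mem_chainWindow (by omega : (0 : ℤ) ≤ n + 1)) σ.rev)ᴴ *
                cAt (-unitVec 0) (neg_unitVec_mem_chainWindow (by omega : (-1 : ℤ) ≤ n + 1)) σ)) *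
        (productOp oddSiteSpinFlip * ρ * (productOp oddSiteSpinFlip)ᴴ)).trace).re =
      ((toSpin ((U : ℂ) • (nAt (-unitVec 0) (neg_unitVec_mem_chainWindow (by omega : (-1 : ℤ) ≤ n + 1)) 0 *
            nAt (-unitVec 0) (neg_unitVec_mem_chainWindow (by omega : (-1 : ℤ) ≤ n + 1)) 1) +
          (-(t : ℂ)) • ∑ σ : Fin 2,
            ((cAt (-unitVec 0) (neg_unitVec_mem_chainWindow (by omega : (-1 : ℤ) ≤ n + 1)) σ)ᴴ *
                cAt 0 (zero_mem_chainWindow (by omega : (0 : ℤ) ≤ n + 1)) σ +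
              (cAt 0 (zero_mem_chainWindow (by omega : (0 : ℤ) ≤ n + 1)) σ)ᴴ *
                cAt (-unitVec 0) (neg_unitVec_mem_chainWindow (by omega : (-1 : ℤ) ≤ n + 1)) σ)) * ρ).trace).re := by
  rw [trace_mul_conj_of_conj (conjTranspose_conj_eq_of_conj_eq spinRot_conjTranspose_mul_self
    (spinRot_conj_toSpin_ksdnBond t U _ _ (zero_apply_eq_neg_unitVec_apply_add_one) (odd_neg_unitVec_apply)))]

end Rows

/-! ### §6 LD1′: the `jw-srot` window statement implies the standard window statement -/

section Transport

/-- **LD1′ (window level). The `jw-srot` `lti(N)` statement implies the standard `lti(N)` statement in FORMAT-ltisdp form.**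
HYPOTHESIS `hclaim` = the by-value node of a `hubbard_jwsrot` row on the window `{-1, …, n+1}` (`N = n + 3` sites): over
`ρ' : Op (PolySite {-1, …, n+1}) 4` — `ρ' ⪰ 0`, `tr ρ' = 1`, local translation invariance `tr_{-1} ρ' = tr_{n+1} ρ'` (as an equality
of pulled-back marginals), the TOTAL-OCCUPATION sector zeros (`N` is the only one-site charge of the `jw-srot` form), total density
of site `-1` equal to `ν`, real entries, `|ρ'| ≤ 1`; conclusion `E ≤ Re tr(toSpin(U n_{-1↑}n_{-1↓} − t Σ_σ (c†_{-1σ} c_{0σ̄} +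
c†_{0σ̄} c_{-1σ})) ρ')`. CONCLUSION: the `hclaim` of `lti_primal_chainWindow_energyDensity[At]_ge_ksdn` (standard form: `(N↑, N↓)`
sectors, bond `U n_{-1↑}n_{-1↓} − t Σ_σ (c†_{-1σ} c_{0σ} + c†_{0σ} c_{-1σ})`). Proof: spin-flip midpoint, then conjugation by
`V = ⨂_x v_x` (module docstring). [cite: KullEtAl2024, §II.B eq. (locTIn), §VI.B] [cite: EsslerEtAl2005, §12.3.4 eqs. (12.196)–(12.201)] -/
theorem ksdnClaim_of_srotClaim (t U : ℝ) (n : ℕ) {ν E : ℝ}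
    (hclaim : ∀ ρ : Op (PolySite (chainWindow (-1) ((n : ℤ) + 1))) 4, ρ.PosSemidef → ρ.trace = 1 →
      spinPartialTrace ((PolySite.affEmb 1 (unitVec 0) (chainWindow (-1) (n : ℤ))).trans
          (PolySite.incl (affShiftSet_chainWindow_subset (-1) (n : ℤ)))) ρ =
        spinPartialTrace (PolySite.incl (chainWindow_mono_right (-1) (by omega : (n : ℤ) ≤ n + 1))) ρ →
      (∀ k k' : TensorIndex (PolySite (chainWindow (-1) ((n : ℤ) + 1))) 4,
        (∑ x, (siteOcc (k x)).card) ≠ (∑ x, (siteOcc (k' x)).card) → ρ k k' = 0) →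
      ((toSpin (nAt (-unitVec 0) (neg_unitVec_mem_chainWindow (by omega : (-1 : ℤ) ≤ n + 1)) 0 +
          nAt (-unitVec 0) (neg_unitVec_mem_chainWindow (by omega : (-1 : ℤ) ≤ n + 1)) 1) * ρ).trace).re = ν →
      (∀ k k' : TensorIndex (PolySite (chainWindow (-1) ((n : ℤ) + 1))) 4, starRingEnd ℂ (ρ k k') = ρ k k') →
      (∀ k k' : TensorIndex (PolySite (chainWindow (-1) ((n : ℤ) + 1))) 4, ‖ρ k k'‖ ≤ 1) →
      E ≤ ((toSpin ((U : ℂ) • (nAt (-unitVec 0) (neg_unitVec_mem_chainWindow (by omega : (-1 : ℤ) ≤ n + 1)) 0 *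
            nAt (-unitVec 0) (neg_unitVec_mem_chainWindow (by omega : (-1 : ℤ) ≤ n + 1)) 1) +
          (-(t : ℂ)) • ∑ σ : Fin 2,
            ((cAt (-unitVec 0) (neg_unitVec_mem_chainWindow (by omega : (-1 : ℤ) ≤ n + 1)) σ)ᴴ *
                cAt 0 (zero_mem_chainWindow (by omega : (0 : ℤ) ≤ n + 1)) σ.rev +
              (cAt 0 (zero_mem_chainWindow (by omega : (0 : ℤ) ≤ n + 1)) σ.rev)ᴴ *
                cAt (-unitVec 0) (neg_unitVec_mem_chainWindow (by omega : (-1 : ℤ) ≤ n + 1)) σ)) * ρ).trace).re) :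
    ∀ ρ : Op (PolySite (chainWindow (-1) ((n : ℤ) + 1))) 4, ρ.PosSemidef → ρ.trace = 1 →
      spinPartialTrace ((PolySite.affEmb 1 (unitVec 0) (chainWindow (-1) (n : ℤ))).trans
          (PolySite.incl (affShiftSet_chainWindow_subset (-1) (n : ℤ)))) ρ =
        spinPartialTrace (PolySite.incl (chainWindow_mono_right (-1) (by omega : (n : ℤ) ≤ n + 1))) ρ →
      (∀ σ : Fin 2, ∀ k k' : TensorIndex (PolySite (chainWindow (-1) ((n : ℤ) + 1))) 4,
        (∑ x, if σ ∈ siteOcc (k x) then 1 else 0 : ℕ) ≠ (∑ x, if σ ∈ siteOcc (k' x) then 1 else 0 : ℕ) → ρ k k' = 0) →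
      ((toSpin (nAt (-unitVec 0) (neg_unitVec_mem_chainWindow (by omega : (-1 : ℤ) ≤ n + 1)) 0 +
          nAt (-unitVec 0) (neg_unitVec_mem_chainWindow (by omega : (-1 : ℤ) ≤ n + 1)) 1) * ρ).trace).re = ν →
      (∀ k k' : TensorIndex (PolySite (chainWindow (-1) ((n : ℤ) + 1))) 4, starRingEnd ℂ (ρ k k') = ρ k k') →
      (∀ k k' : TensorIndex (PolySite (chainWindow (-1) ((n : ℤ) + 1))) 4, ‖ρ k k'‖ ≤ 1) →
      E ≤ ((toSpin ((U : ℂ) • (nAt (-unitVec 0) (neg_unitVec_mem_chainWindow (by omega : (-1 : ℤ) ≤ n + 1)) 0 *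
            nAt (-unitVec 0) (neg_unitVec_mem_chainWindow (by omega : (-1 : ℤ) ≤ n + 1)) 1) +
          (-(t : ℂ)) • ∑ σ : Fin 2,
            ((cAt (-unitVec 0) (neg_unitVec_mem_chainWindow (by omega : (-1 : ℤ) ≤ n + 1)) σ)ᴴ *
                cAt 0 (zero_mem_chainWindow (by omega : (0 : ℤ) ≤ n + 1)) σ +
              (cAt 0 (zero_mem_chainWindow (by omega : (0 : ℤ) ≤ n + 1)) σ)ᴴ *
                cAt (-unitVec 0) (neg_unitVec_mem_chainWindow (by omega : (-1 : ℤ) ≤ n + 1)) σ)) * ρ).trace).re := by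
  intro ρ hpos htr hlti hsec hdens hreal _
  -- Step 1: the spin-flip midpoint `ρ₁ = ½(ρ + F ρ Fᴴ)`
  set F : Op (PolySite (chainWindow (-1) ((n : ℤ) + 1))) 4 := productOp (fun _ => uSpinFlip)
  have hFF : Fᴴ * F = 1 := spinFlip_conjTranspose_mul_self
  have pos' : (F * ρ * Fᴴ).PosSemidef := conj_posSemidef F hpos
  have tr' : (F * ρ * Fᴴ).trace = 1 := by rw [conj_trace hFF]; exact htr
  have lti' := spinFlip_ltiRow n hlti
  have sec' := fun σ k k' hk => spinFlip_sectorRow hsec σ k k' hk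
  have dens' := spinFlip_ksdnDensityRow n hdens
  have real' := fun k k' => spinFlip_realRow hreal k k'
  set ρ₁ : Op (PolySite (chainWindow (-1) ((n : ℤ) + 1))) 4 := (2 : ℂ)⁻¹ • (ρ + F * ρ * Fᴴ)
  have pos₁ : ρ₁.PosSemidef := posSemidef_midpoint hpos pos'
  have tr₁ : ρ₁.trace = 1 := trace_midpoint htr tr'
  have lti₁ : spinPartialTrace ((PolySite.affEmb 1 (unitVec 0) (chainWindow (-1) (n : ℤ))).trans
        (PolySite.incl (affShiftSet_chainWindow_subset (-1) (n : ℤ)))) ρ₁ =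
      spinPartialTrace (PolySite.incl (chainWindow_mono_right (-1) (by omega : (n : ℤ) ≤ n + 1))) ρ₁ :=
    linearRow_midpoint _ _ hlti lti'
  have sec₁ : ∀ σ : Fin 2, ∀ k k' : TensorIndex (PolySite (chainWindow (-1) ((n : ℤ) + 1))) 4,
      (∑ x, if σ ∈ siteOcc (k x) then 1 else 0 : ℕ) ≠ (∑ x, if σ ∈ siteOcc (k' x) then 1 else 0 : ℕ) → ρ₁ k k' = 0 :=
    fun σ k k' hk => apply_midpoint_eq_zero (hsec σ k k' hk) (sec' σ k k' hk)
  have dens₁ := re_trace_mul_midpoint _ hdens dens'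
  have real₁ : ∀ k k', starRingEnd ℂ (ρ₁ k k') = ρ₁ k k' := fun k k' => conj_apply_midpoint hreal real' k k'
  have inv₁ : F * ρ₁ * Fᴴ = ρ₁ := conj_midpoint_self F ρ (spinFlip_sq_conj ρ)
  have obj₁ := re_trace_mul_midpoint _ rfl (spinFlip_ksdnObjective n t U ρ)
  -- Step 2: conjugation by the staggered product `V = ⨂_x v_x`
  set V : Op (PolySite (chainWindow (-1) ((n : ℤ) + 1))) 4 := productOp oddSiteSpinFlip
  have hVV : Vᴴ * V = 1 := spinRot_conjTranspose_mul_self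
  have pos₂ : (V * ρ₁ * Vᴴ).PosSemidef := conj_posSemidef V pos₁
  have tr₂ : (V * ρ₁ * Vᴴ).trace = 1 := by rw [conj_trace hVV]; exact tr₁
  have lti₂ := spinRot_ltiRow n lti₁ inv₁
  have sec₂ : ∀ k k' : TensorIndex (PolySite (chainWindow (-1) ((n : ℤ) + 1))) 4,
      (∑ x, (siteOcc (k x)).card) ≠ (∑ x, (siteOcc (k' x)).card) → (V * ρ₁ * Vᴴ) k k' = 0 :=
    fun k k' hk => spinRot_sectorRow (fun l l' hl => totSectorRow_of_sectorRow sec₁ l l' hl) k k' hk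
  have dens₂ := spinRot_ksdnDensityRow n dens₁
  have real₂ : ∀ k k', starRingEnd ℂ ((V * ρ₁ * Vᴴ) k k') = (V * ρ₁ * Vᴴ) k k' := fun k k' => spinRot_realRow real₁ k k'
  have norm₂ : ∀ k k', ‖(V * ρ₁ * Vᴴ) k k'‖ ≤ 1 := norm_apply_le_one_of_posSemidef pos₂ tr₂
  -- Step 3: the `jw-srot` bound at `V ρ₁ Vᴴ` is the standard bound at `ρ`
  have key := hclaim (V * ρ₁ * Vᴴ) pos₂ tr₂ lti₂ sec₂ dens₂ real₂ norm₂
  exact key.trans_eq ((spinRot_srotObjective n t U ρ₁).trans obj₁)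

end Transport

end Summit.Ventures.CertifiedManyBodySolver.Transport
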